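import Summits.CriticalPhenomena.PercolationContinuityZ3.Theorems.FK.PressureBetaConvexity
import Literature.Probability.LatticeModels.LebowitzCoexistence
import Literature.Probability.LatticeModels.MagnetizationExponentUpperProofs
import HarnessLib

/-!
# THE ENERGY IS THE `β`-DERIVATIVE OF THE PRESSURE: `∂⁺ψ/∂β (β,0) = Σᵢ ⟨σ_0σ_{eᵢ}⟩⁺_β`, `∂⁻ψ/∂β (β,0) = Σᵢ ⟨σ_0σ_{eᵢ}⟩^∅_β`,
# AND `ψ(·,0)` IS DIFFERENTIABLE AT `β` IFF THE FREE AND PLUS NEAREST-NEIGHBOUR ENERGIES AGREE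
# (Lebowitz 1977, §3, p. 470 "general arguments" and Thm. 2; Friedli–Velenik 2017, §3.2.1, Exercise 3.17)

Claimed R42 (8)(c) in the cell INBOX at 2026-08-29T00:59:05Z by fkp-10a gen 357 (NEW CLAIM #1 of the gen), addressed to coordinator fk-4 (next seated gen; gen 284 CLOSED l.8632; (ι) in force for windows); lineage row FO-10a-g357 (self-suggested), package g357-energy, label EB-B.
Helper file of the `fk-continuity` build cell (bschramm lane; `--supports stmt-CriticalPhenomena-4575`); builds on
p205010 (kernel theorem, internal audit signed; external expert review pending). No definitions, no named facts, no
sorries; standard axioms. UNCONDITIONAL (nearest-neighbour Ising model on `ℤ^d` at zero field, every `d`).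

Lebowitz (J. Stat. Phys. 16 (1977), §3, proof of Thm. 2, p. 470): "it follows from general arguments that
`∂Ψ(β₀ ± 0)/∂β` … the energies of all translation invariant states lie between these one-sided derivatives". In the
tree's elementary chord form (`PressureBetaConvexity`): `Σᵢ ⟨σ_0σ_{eᵢ}⟩⁺_{β'} ≤ slope ψ(·,0) β' β ≤ Σᵢ ⟨σ_0σ_{eᵢ}⟩^∅_β` for
`0 ≤ β' < β`. Since `β ↦ ⟨σ_A⟩⁺_β` is right-continuous (`plusCorr_continuousWithinAt_Ici`, Friedli–Velenik Exercise 3.17)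
and `β ↦ ⟨σ_A⟩^∅_β` is left-continuous (`freeCorr_continuousWithinAt_Iic`), and `⟨·⟩^∅ ≤ ⟨·⟩⁺`, the two one-sided
squeezes close:

* **`hasDerivWithinAt_pressure_beta_Ici`** — for every `β ≥ 0`: `∂⁺ψ/∂β (β,0) = Σᵢ ⟨σ_0σ_{eᵢ}⟩⁺_β` — the RIGHT
  `β`-derivative of the pressure is the plus-state nearest-neighbour energy;
* **`hasDerivWithinAt_pressure_beta_Iic`** — for every `β > 0`: `∂⁻ψ/∂β (β,0) = Σᵢ ⟨σ_0σ_{eᵢ}⟩^∅_β` — the LEFT derivative is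
  the free-state energy; `derivWithin_pressure_beta_Ici`, `derivWithin_pressure_beta_Iic`;
* **`differentiableAt_pressure_beta_iff`** — **Lebowitz 1977, Thm. 2 ("`Ψ` differentiable in `β`" ⟺ equal energies)**:
  for `β > 0`, `ψ(·,0)` is differentiable at `β` iff `Σᵢ ⟨σ_0σ_{eᵢ}⟩^∅_β = Σᵢ ⟨σ_0σ_{eᵢ}⟩⁺_β` iff
  `⟨σ_0σ_{eᵢ}⟩^∅_β = ⟨σ_0σ_{eᵢ}⟩⁺_β` for every direction `i` (`differentiableAt_pressure_beta_iff_forall`), and then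
  `deriv ψ(·,0) β = Σᵢ ⟨σ_0σ_{eᵢ}⟩⁺_β` (`hasDerivAt_pressure_beta_of_nn_freeCorr_eq_plusCorr`, `deriv_pressure_beta_eq`);
* `hasDerivAt_pressure_beta_of_continuousAt` — at every continuity point `β > 0` of the plus energy
  `b ↦ Σᵢ ⟨σ_0σ_{eᵢ}⟩⁺_{max b 0}`, `ψ(·,0)` is differentiable; hence **`countable_not_differentiableAt_pressure_beta`** —
  `ψ(·,0)` is differentiable, with derivative the (common) nearest-neighbour energy, OFF A COUNTABLE SET of `β > 0`
  (Lebowitz 1977, Remark (i));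
* **`derivWithin_Iic_le_sum_spinCorr_nn`**, **`sum_spinCorr_nn_le_derivWithin_Ici`** — LEBOWITZ'S SANDWICH, literally:
  for every translation invariant Gibbs state `μ ∈ 𝒢(β,0)`, `β > 0`,
  `∂⁻ψ/∂β (β,0) ≤ Σᵢ ⟨σ_0σ_{eᵢ}⟩_μ ≤ ∂⁺ψ/∂β (β,0)`; and `sum_spinCorr_nn_eq_deriv_pressure_beta` — where `ψ(·,0)` is
  differentiable, ALL translation invariant Gibbs states have the nearest-neighbour energy `deriv ψ(·,0) β`.

## References

* J. L. Lebowitz, *Coexistence of phases in Ising ferromagnets*, J. Stat. Phys. 16 (1977) 463–476, §3, Thm. 2, proof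
  p. 470, Remark (i) p. 471. [Lebowitz1977]
* S. Friedli, Y. Velenik, *Statistical Mechanics of Lattice Systems*, CUP (2017), §3.2.1 (Lemma 3.5, Thm. 3.6),
  Exercise 3.16, Exercise 3.17, Lemma 3.31. [FriedliVelenik2017]
* M. Aizenman, H. Duminil-Copin, V. Sidoravicius, Comm. Math. Phys. 334 (2015) 719–742, §3.3 (left-continuity of the
  free state in `β`). [AizenmanDuminilCopinSidoraviciusCMP2015]
* R. T. Rockafellar, *Convex Analysis*, Princeton (1970), Thm. 24.1, Thm. 25.3. [Rockafellar1970]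
-/

noncomputable section

namespace Summit.CriticalPhenomena.PercolationContinuityZ3.Theorems.FK

namespace IsingEnergyDensity

open MeasureTheory Filter Topology Finset Set
open Literature.Probability.LatticeModels
open Summit.CriticalPhenomena.PercolationContinuityZ3.Theorems.FK.ConcaveLimit

variable {d : ℕ}

/-! ### One-sided continuity of the nearest-neighbour energies in `β` -/

/-- The plus nearest-neighbour energy `β ↦ Σᵢ ⟨σ_0σ_{eᵢ}⟩⁺_β` is right-continuous at every `β ≥ 0`.
[cite: FriedliVelenik2017, Exercise 3.17] -/
theorem tendsto_sum_plusCorr_nn_nhdsGT {β : ℝ} (hβ : 0 ≤ β) :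
    Tendsto (fun b => ∑ i, plusCorr d b 0 {0, Pi.single i 1}) (𝓝[>] β)
      (𝓝 (∑ i, plusCorr d β 0 {0, Pi.single i 1})) :=
  (tendsto_finsetSum _ fun i _ => (plusCorr_continuousWithinAt_Ici (d := d) le_rfl {0, Pi.single i 1} hβ).tendsto).mono_left
    (nhdsWithin_mono _ Ioi_subset_Ici_self)

/-- The free nearest-neighbour energy `β ↦ Σᵢ ⟨σ_0σ_{eᵢ}⟩^∅_β` is left-continuous at every `β > 0`.
[cite: AizenmanDuminilCopinSidoraviciusCMP2015, §3.3; FriedliVelenik2017, Exercise 3.16] -/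
theorem tendsto_sum_freeCorr_nn_nhdsLT {β : ℝ} (hβ : 0 < β) :
    Tendsto (fun b => ∑ i, freeCorr d b 0 {0, Pi.single i 1}) (𝓝[<] β)
      (𝓝 (∑ i, freeCorr d β 0 {0, Pi.single i 1})) :=
  (tendsto_finsetSum _ fun i _ => (freeCorr_continuousWithinAt_Iic (d := d) le_rfl {0, Pi.single i 1} hβ).tendsto).mono_left
    (nhdsWithin_mono _ Iio_subset_Iic_self)

/-! ### THE ONE-SIDED `β`-DERIVATIVES OF THE PRESSURE -/

/-- **`∂⁺ψ/∂β (β,0) = Σᵢ ⟨σ_0σ_{eᵢ}⟩⁺_β` FOR EVERY `β ≥ 0`**: the pressure of the nearest-neighbour Ising model on `ℤ^d` at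
zero field has RIGHT `β`-derivative the plus-state nearest-neighbour energy,
`lim_{b↓β} (ψ(b,0) − ψ(β,0))/(b − β) = Σ_{i=1}^d ⟨σ_0σ_{eᵢ}⟩⁺_β` (chords squeezed between `Σᵢ ⟨σ_0σ_{eᵢ}⟩⁺_β` and
`Σᵢ ⟨σ_0σ_{eᵢ}⟩⁺_b`, right-continuity of the plus state in `β`).
[cite: Lebowitz1977, §3, proof of Thm. 2, p. 470; FriedliVelenik2017, Exercise 3.17] -/
theorem hasDerivWithinAt_pressure_beta_Ici {β : ℝ} (hβ : 0 ≤ β) :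
    HasDerivWithinAt (fun b => pressure d b 0) (∑ i, plusCorr d β 0 {0, Pi.single i 1}) (Ici β) β := by
  rw [← hasDerivWithinAt_Ioi_iff_Ici]
  refine hasDerivWithinAt_Ioi_of_slope_squeeze_convex (u := fun b => ∑ i, plusCorr d b 0 {0, Pi.single i 1}) ?_ ?_
    (tendsto_sum_plusCorr_nn_nhdsGT hβ)
  · filter_upwards [self_mem_nhdsWithin] with b hb
    exact sum_plusCorr_nn_le_slope_pressure_beta hβ hb
  · filter_upwards [self_mem_nhdsWithin] with b hb
    exact slope_pressure_beta_le_sum_plusCorr_nn (hβ.trans (le_of_lt hb)) hb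

/-- **`∂⁻ψ/∂β (β,0) = Σᵢ ⟨σ_0σ_{eᵢ}⟩^∅_β` FOR EVERY `β > 0`**: the LEFT `β`-derivative of the pressure is the free-state
nearest-neighbour energy (chords from the left squeezed between `Σᵢ ⟨σ_0σ_{eᵢ}⟩^∅_b` and `Σᵢ ⟨σ_0σ_{eᵢ}⟩^∅_β`,
left-continuity of the free state in `β`). [cite: Lebowitz1977, §3, proof of Thm. 2, p. 470; AizenmanDuminilCopinSidoraviciusCMP2015, §3.3] -/
theorem hasDerivWithinAt_pressure_beta_Iic {β : ℝ} (hβ : 0 < β) :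
    HasDerivWithinAt (fun b => pressure d b 0) (∑ i, freeCorr d β 0 {0, Pi.single i 1}) (Iic β) β := by
  rw [← hasDerivWithinAt_Iio_iff_Iic]
  refine hasDerivWithinAt_Iio_of_slope_squeeze_convex (u := fun b => ∑ i, freeCorr d b 0 {0, Pi.single i 1}) ?_ ?_
    (tendsto_sum_freeCorr_nn_nhdsLT hβ)
  · filter_upwards [Ioo_mem_nhdsLT hβ] with b hb
    exact sum_freeCorr_nn_le_slope_pressure_beta hb.1.le hb.2
  · filter_upwards [self_mem_nhdsWithin] with b hb
    exact slope_pressure_beta_le_sum_freeCorr_nn hβ.le hb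

/-- `derivWithin ψ(·,0) [β,∞) β = Σᵢ ⟨σ_0σ_{eᵢ}⟩⁺_β` (`β ≥ 0`). [cite: Lebowitz1977, §3, proof of Thm. 2, p. 470] -/
theorem derivWithin_pressure_beta_Ici {β : ℝ} (hβ : 0 ≤ β) :
    derivWithin (fun b => pressure d b 0) (Ici β) β = ∑ i, plusCorr d β 0 {0, Pi.single i 1} :=
  (hasDerivWithinAt_pressure_beta_Ici hβ).derivWithin (uniqueDiffWithinAt_Ici β)

/-- `derivWithin ψ(·,0) (−∞,β] β = Σᵢ ⟨σ_0σ_{eᵢ}⟩^∅_β` (`β > 0`). [cite: Lebowitz1977, §3, proof of Thm. 2, p. 470] -/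
theorem derivWithin_pressure_beta_Iic {β : ℝ} (hβ : 0 < β) :
    derivWithin (fun b => pressure d b 0) (Iic β) β = ∑ i, freeCorr d β 0 {0, Pi.single i 1} :=
  (hasDerivWithinAt_pressure_beta_Iic hβ).derivWithin (uniqueDiffWithinAt_Iic β)

/-- **`∂⁻ψ/∂β ≤ ∂⁺ψ/∂β`**: `Σᵢ ⟨σ_0σ_{eᵢ}⟩^∅_β ≤ Σᵢ ⟨σ_0σ_{eᵢ}⟩⁺_β` (`β ≥ 0`, GKS / FKG comparison of the states).
[cite: FriedliVelenik2017, Lemma 3.31; Lebowitz1977, §3, p. 470] -/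
theorem sum_freeCorr_nn_le_sum_plusCorr_nn {β : ℝ} (hβ : 0 ≤ β) :
    ∑ i, freeCorr d β 0 {0, Pi.single i 1} ≤ ∑ i, plusCorr d β 0 {0, Pi.single i 1} :=
  sum_le_sum fun _ _ => freeCorr_le_plusCorr hβ le_rfl _

/-! ### DIFFERENTIABILITY ⟺ EQUAL FREE AND PLUS ENERGIES (Lebowitz 1977, Thm. 2) -/

/-- If the free and plus nearest-neighbour energies agree at `β > 0`, `ψ(·,0)` is differentiable at `β` with derivative
that energy. [cite: Lebowitz1977, §3, Thm. 2, p. 470] -/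
theorem hasDerivAt_pressure_beta_of_sum_eq {β : ℝ} (hβ : 0 < β)
    (heq : ∑ i, freeCorr d β 0 {0, Pi.single i 1} = ∑ i, plusCorr d β 0 {0, Pi.single i 1}) :
    HasDerivAt (fun b => pressure d b 0) (∑ i, plusCorr d β 0 {0, Pi.single i 1}) β := by
  have h1 := hasDerivWithinAt_pressure_beta_Iic (d := d) hβ
  rw [heq] at h1
  have h := h1.union (hasDerivWithinAt_pressure_beta_Ici (d := d) hβ.le)
  rw [Iic_union_Ici, hasDerivWithinAt_univ] at h
  exact h

/-- If `⟨σ_0σ_{eᵢ}⟩^∅_β = ⟨σ_0σ_{eᵢ}⟩⁺_β` for every direction `i` (`β > 0`), then `ψ(·,0)` is differentiable at `β` with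
`∂ψ/∂β (β,0) = Σᵢ ⟨σ_0σ_{eᵢ}⟩⁺_β`. [cite: Lebowitz1977, §3, Thm. 2, p. 470] -/
theorem hasDerivAt_pressure_beta_of_nn_freeCorr_eq_plusCorr {β : ℝ} (hβ : 0 < β)
    (hfp : ∀ i : Fin d, freeCorr d β 0 {0, Pi.single i 1} = plusCorr d β 0 {0, Pi.single i 1}) :
    HasDerivAt (fun b => pressure d b 0) (∑ i, plusCorr d β 0 {0, Pi.single i 1}) β :=
  hasDerivAt_pressure_beta_of_sum_eq hβ (sum_congr rfl fun i _ => hfp i)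

/-- **LEBOWITZ 1977, THM. 2 — `ψ(·,0)` IS DIFFERENTIABLE AT `β > 0` IFF THE FREE AND PLUS NEAREST-NEIGHBOUR ENERGIES
AGREE**: `DifferentiableAt ℝ ψ(·,0) β ↔ Σᵢ ⟨σ_0σ_{eᵢ}⟩^∅_β = Σᵢ ⟨σ_0σ_{eᵢ}⟩⁺_β` (the two one-sided derivatives).
[cite: Lebowitz1977, §3, Thm. 2 and its proof, p. 470] -/
theorem differentiableAt_pressure_beta_iff {β : ℝ} (hβ : 0 < β) :
    DifferentiableAt ℝ (fun b => pressure d b 0) β ↔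
      ∑ i, freeCorr d β 0 {0, Pi.single i 1} = ∑ i, plusCorr d β 0 {0, Pi.single i 1} := by
  refine ⟨fun hd => ?_, fun heq => (hasDerivAt_pressure_beta_of_sum_eq hβ heq).differentiableAt⟩
  have h1 : deriv (fun b => pressure d b 0) β = ∑ i, freeCorr d β 0 {0, Pi.single i 1} :=
    (uniqueDiffWithinAt_Iic β).eq_deriv _ hd.hasDerivAt.hasDerivWithinAt (hasDerivWithinAt_pressure_beta_Iic hβ)
  have h2 : deriv (fun b => pressure d b 0) β = ∑ i, plusCorr d β 0 {0, Pi.single i 1} :=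
    (uniqueDiffWithinAt_Ici β).eq_deriv _ hd.hasDerivAt.hasDerivWithinAt (hasDerivWithinAt_pressure_beta_Ici hβ.le)
  rw [← h1, ← h2]

/-- **Termwise form**: `ψ(·,0)` is differentiable at `β > 0` iff `⟨σ_0σ_{eᵢ}⟩^∅_β = ⟨σ_0σ_{eᵢ}⟩⁺_β` for EVERY direction
`i` (each term satisfies `⟨·⟩^∅ ≤ ⟨·⟩⁺`). [cite: Lebowitz1977, §3, Thm. 2, p. 470] -/
theorem differentiableAt_pressure_beta_iff_forall {β : ℝ} (hβ : 0 < β) :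
    DifferentiableAt ℝ (fun b => pressure d b 0) β ↔
      ∀ i : Fin d, freeCorr d β 0 {0, Pi.single i 1} = plusCorr d β 0 {0, Pi.single i 1} := by
  rw [differentiableAt_pressure_beta_iff hβ]
  refine ⟨fun heq i => ?_, fun hfp => sum_congr rfl fun i _ => hfp i⟩
  have hterm : ∀ j ∈ (univ : Finset (Fin d)),
      0 ≤ plusCorr d β 0 {0, Pi.single j 1} - freeCorr d β 0 {0, Pi.single j 1} :=
    fun j _ => sub_nonneg.2 (freeCorr_le_plusCorr hβ.le le_rfl _)
  have hsum0 : ∑ j, (plusCorr d β 0 {0, Pi.single j 1} - freeCorr d β 0 {0, Pi.single j 1}) = 0 := by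
    rw [sum_sub_distrib, heq, sub_self]
  have := (sum_eq_zero_iff_of_nonneg hterm).1 hsum0 i (mem_univ i)
  linarith

/-- **Wherever `ψ(·,0)` is differentiable at `β > 0`, `∂ψ/∂β (β,0) = Σᵢ ⟨σ_0σ_{eᵢ}⟩⁺_β` (`= Σᵢ ⟨σ_0σ_{eᵢ}⟩^∅_β`).**
[cite: Lebowitz1977, §3, Thm. 2, p. 470] -/
theorem deriv_pressure_beta_eq {β : ℝ} (hβ : 0 < β) (hd : DifferentiableAt ℝ (fun b => pressure d b 0) β) :
    deriv (fun b => pressure d b 0) β = ∑ i, plusCorr d β 0 {0, Pi.single i 1} :=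
  (hasDerivAt_pressure_beta_of_sum_eq hβ ((differentiableAt_pressure_beta_iff hβ).1 hd)).deriv

/-- The free form of the derivative: where `ψ(·,0)` is differentiable at `β > 0`, `∂ψ/∂β (β,0) = Σᵢ ⟨σ_0σ_{eᵢ}⟩^∅_β`.
[cite: Lebowitz1977, §3, Thm. 2, p. 470] -/
theorem deriv_pressure_beta_eq_sum_freeCorr_nn {β : ℝ} (hβ : 0 < β)
    (hd : DifferentiableAt ℝ (fun b => pressure d b 0) β) :
    deriv (fun b => pressure d b 0) β = ∑ i, freeCorr d β 0 {0, Pi.single i 1} := by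
  rw [deriv_pressure_beta_eq hβ hd, (differentiableAt_pressure_beta_iff hβ).1 hd]

/-! ### Differentiability off a countable set (Lebowitz 1977, Remark (i)) -/

/-- **At every continuity point `β > 0` of the plus energy `b ↦ Σᵢ ⟨σ_0σ_{eᵢ}⟩⁺_{max b 0}`, `ψ(·,0)` is differentiable**
(there the free and plus energies agree, tree theorem `nn_freeCorr_eq_plusCorr_of_continuousAt`).
[cite: Lebowitz1977, §3, Thm. 2 and Remark (i), pp. 470–471] -/
theorem hasDerivAt_pressure_beta_of_continuousAt {β : ℝ} (hβ : 0 < β)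
    (hcont : ContinuousAt (fun b : ℝ => ∑ i : Fin d, plusCorr d (max b 0) 0 {0, Pi.single i 1}) β) :
    HasDerivAt (fun b => pressure d b 0) (∑ i, plusCorr d β 0 {0, Pi.single i 1}) β :=
  hasDerivAt_pressure_beta_of_nn_freeCorr_eq_plusCorr hβ (nn_freeCorr_eq_plusCorr_of_continuousAt hβ hcont)

/-- **`ψ(·,0)` IS DIFFERENTIABLE OFF A COUNTABLE SET OF INVERSE TEMPERATURES**: the set of `β > 0` at which
`b ↦ ψ(b,0)` is not differentiable is countable (contained in the discontinuity set of the monotone plus energy).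
[cite: Lebowitz1977, §3, Remark (i), p. 471; Rockafellar1970, Thm. 25.3] -/
theorem countable_not_differentiableAt_pressure_beta :
    Set.Countable {β : ℝ | 0 < β ∧ ¬ DifferentiableAt ℝ (fun b => pressure d b 0) β} := by
  set Pt : ℝ → ℝ := fun b => ∑ i : Fin d, plusCorr d (max b 0) 0 {0, Pi.single i 1} with hPt
  have hmono : Monotone Pt := by
    intro a b hab
    simp only [hPt]
    exact sum_le_sum fun i _ =>
      plusCorr_mono_params (le_max_right a 0) (max_le_max hab le_rfl) le_rfl le_rfl _
  refine hmono.countable_not_continuousAt.mono fun β hβ => ?_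
  exact fun hc => hβ.2 (hasDerivAt_pressure_beta_of_continuousAt hβ.1 hc).differentiableAt

/-! ### LEBOWITZ'S SANDWICH: the energies of the translation invariant states lie between `∂⁻ψ/∂β` and `∂⁺ψ/∂β` -/

/-- **`∂⁻ψ/∂β (β,0) ≤ Σᵢ ⟨σ_0σ_{eᵢ}⟩_μ`** for every translation invariant Gibbs state `μ ∈ 𝒢(β,0)`, `β > 0` (the free
energy is the smallest: tree theorem `sum_freeCorr_nn_le_sum_spinCorr_nn_of_isTranslationInvariant`).
[cite: Lebowitz1977, §3, proof of Thm. 2, p. 470] -/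
theorem derivWithin_Iic_le_sum_spinCorr_nn {β : ℝ} (hβ : 0 < β) {μ : Measure (SpinConfig (Site d))}
    (hμG : μ ∈ isingGibbsMeasures d β 0) (hμT : IsTranslationInvariantMeasure μ) :
    derivWithin (fun b => pressure d b 0) (Iic β) β ≤ ∑ i, spinCorr μ {0, Pi.single i 1} := by
  rw [derivWithin_pressure_beta_Iic hβ]
  exact sum_freeCorr_nn_le_sum_spinCorr_nn_of_isTranslationInvariant hβ hμG hμT

/-- **`Σᵢ ⟨σ_0σ_{eᵢ}⟩_μ ≤ ∂⁺ψ/∂β (β,0)`** for every Gibbs state `μ ∈ 𝒢(β,0)`, `β ≥ 0` (the plus state dominates every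
Gibbs state on pair correlations, tree theorem `spinCorr_le_plusCorr_of_isGibbsMeasure`).
[cite: Lebowitz1977, §3, proof of Thm. 2, p. 470] -/
theorem sum_spinCorr_nn_le_derivWithin_Ici {β : ℝ} (hβ : 0 ≤ β) {μ : Measure (SpinConfig (Site d))}
    (hμG : μ ∈ isingGibbsMeasures d β 0) :
    ∑ i, spinCorr μ {0, Pi.single i 1} ≤ derivWithin (fun b => pressure d b 0) (Ici β) β := by
  rw [derivWithin_pressure_beta_Ici hβ]
  exact sum_le_sum fun i _ => spinCorr_le_plusCorr_of_isGibbsMeasure hβ le_rfl hμG _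

/-- **Where `ψ(·,0)` is differentiable, all translation invariant Gibbs states have the same nearest-neighbour energy
`∂ψ/∂β`**: for `β > 0`, `μ ∈ 𝒢(β,0)` translation invariant and `ψ(·,0)` differentiable at `β`,
`Σᵢ ⟨σ_0σ_{eᵢ}⟩_μ = deriv ψ(·,0) β`. [cite: Lebowitz1977, §3, Thm. 2, p. 470] -/
theorem sum_spinCorr_nn_eq_deriv_pressure_beta {β : ℝ} (hβ : 0 < β)
    (hd : DifferentiableAt ℝ (fun b => pressure d b 0) β) {μ : Measure (SpinConfig (Site d))}
    (hμG : μ ∈ isingGibbsMeasures d β 0) (hμT : IsTranslationInvariantMeasure μ) :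
    ∑ i, spinCorr μ {0, Pi.single i 1} = deriv (fun b => pressure d b 0) β := by
  apply le_antisymm
  · have h := sum_spinCorr_nn_le_derivWithin_Ici hβ.le hμG
    rwa [derivWithin_pressure_beta_Ici hβ.le, ← deriv_pressure_beta_eq hβ hd] at h
  · have h := derivWithin_Iic_le_sum_spinCorr_nn hβ hμG hμT
    rwa [derivWithin_pressure_beta_Iic hβ, ← deriv_pressure_beta_eq_sum_freeCorr_nn hβ hd] at h

/-- **Termwise**: where `ψ(·,0)` is differentiable at `β > 0`, every translation invariant `μ ∈ 𝒢(β,0)` has the plus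
nearest-neighbour correlations, `⟨σ_xσ_{x+eᵢ}⟩_μ = ⟨σ_xσ_{x+eᵢ}⟩⁺_β` (tree theorem
`nn_spinCorr_eq_plusCorr_of_isTranslationInvariant` under the differentiability hypothesis).
[cite: Lebowitz1977, §3, Thm. 2, p. 470] -/
theorem nn_spinCorr_eq_plusCorr_of_differentiableAt {β : ℝ} (hβ : 0 < β)
    (hd : DifferentiableAt ℝ (fun b => pressure d b 0) β) {μ : Measure (SpinConfig (Site d))}
    (hμG : μ ∈ isingGibbsMeasures d β 0) (hμT : IsTranslationInvariantMeasure μ) (x : Site d) (i : Fin d) :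
    spinCorr μ {x, x + Pi.single i 1} = plusCorr d β 0 {x, x + Pi.single i 1} :=
  nn_spinCorr_eq_plusCorr_of_isTranslationInvariant hβ ((differentiableAt_pressure_beta_iff_forall hβ).1 hd) hμG hμT x i

end IsingEnergyDensity

end Summit.CriticalPhenomena.PercolationContinuityZ3.Theorems.FK

end
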